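import Literature.AlgebraicGeometry.Resolution.CompletionFiniteAlgebra
import Literature.AlgebraicGeometry.Resolution.AdicCompletionRegular
import Literature.AlgebraicGeometry.Resolution.CompleteLocalDomainNormalization
import Mathlib.RingTheory.DedekindDomain.IntegralClosure
import Mathlib.RingTheory.Flat.Basic
import Mathlib.RingTheory.AdicCompletion.LocalRing
import Mathlib.RingTheory.Ideal.MinimalPrime.Localization
import Mathlib.RingTheory.KrullDimension.LocalRing
import Mathlib.RingTheory.Nilpotent.Lemmas
import HarnessLib

/-!
# Analytically unramified one-dimensional local domains (Krull 1930; Kollár, Thm. 1.101), I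

Topic: `Literature/AlgebraicGeometry/Resolution`. Kollár, *Lectures on Resolution of
Singularities* (2007), §1.13, **Theorem 1.101** [Kru30, Satz 7]: for a one-dimensional
semi-local ring `S` without embedded points the following are equivalent: (1) the blow-up
sequence of Algorithm 1.100 stabilizes at regular rings; (2) `S` is reduced and the
normalization `S̄` is finite over `S`; (3) the completion `Ŝ` is reduced. This file and its
sequel `OneDimAnalyticallyUnramifiedFinite.lean` PROVE (2) ⇔ (3) for one-dimensional Noetherian
local DOMAINS `R` (the case vendored as the named fact
`Literature.Barriers.ResolutionOfSingularities.QuasiExcellence.Krull1930_Kollar_1_101`), on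
Mathlib's `integralClosure R (FractionRing R)` and `AdicCompletion (maximalIdeal R) R`.
Everything here is PROVED; no definitions, no named facts.

## Content (namespace `Literature.AlgebraicGeometry.Resolution`)

* `isReduced_adicCompletion_of_finite_integralClosure` — **(2) ⇒ (3)**, the printed proof
  (Kollár p. 59, fourth step): `R̄` finite ⇒ `R̄` is a Dedekind domain, so each `R̄_𝔫` is regular
  and `(R̄_𝔫)^` is a regular local ring (`isRegularLocalRing_adicCompletion`), hence a domain;
  `R̂ ↪ R̄ ⊗_R R̂ ≅ Π_𝔫 (R̄_𝔫)^` (flatness of `R̂`; Matsumura 8.7 + 8.15 = the tree's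
  `Stacks07N9_local`) is therefore reduced.
* Bricks for **(3) ⇒ (2)** (assembled in the sequel; NOT the printed descent through the
  blow-up sequence (1), but a conductor descent):
  - `exists_homogeneous_rel_of_isIntegral` / `isIntegral_div_of_homogeneous_rel` — `a/s` is
    integral iff `aⁿ + Σ_{i<n} cᵢ aⁱ sⁿ⁻ⁱ = 0`, a first-order relation that can be pushed
    along ring homomorphisms;
  - `exists_pow_mul_mem_range_of_complete` — for a complete one-dimensional local domain `D`
    and `y ∈ 𝔪_D`, some `y^N` conducts `D̄` into `D` (finiteness of `D̄`: Kollár Thm. 1.102 /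
    Kiyek–Vicente II (3.17), the tree's `module_finite_integralClosure_of_complete`);
  - `exists_notMem_minimalPrimes_forall_mul_mem` — patching modulo the minimal primes of a
    reduced ring: an `e` outside all minimal primes with `e·z ∈ I` whenever `z ∈ I + 𝔭` for
    all minimal `𝔭`;
  - `exists_pow_mem_span_of_notMem_minimalPrimes` — in a local ring of dimension `≤ 1` such an
    `e` divides a power of every `x ∈ 𝔪`.

## Sources

* J. Kollár, *Lectures on Resolution of Singularities*, Ann. of Math. Stud. 166, Princeton
  2007, §1.13, Thm. 1.101 and its proof, Thm. 1.102 (PDF pp. 58–59 of the held copy).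
  [Kollar2007]
* W. Krull, *Ein Satz über primäre Integritätsbereiche*, Math. Ann. 103 (1930), Satz 7 (as
  cited by Kollár).
-/

noncomputable section

open IsLocalRing Polynomial TensorProduct

namespace Literature.AlgebraicGeometry.Resolution

universe u

/-! ## `(2) ⇒ (3)`: finite normalization forces a reduced completion -/

section FiniteNormalization

variable (R : Type u) [CommRing R] [IsDomain R] [IsNoetherianRing R]

/-- If the normalization of a Noetherian domain of dimension `≤ 1` is module-finite, it is a
Dedekind domain (Noetherian, integrally closed, of dimension `≤ 1`). [folklore] -/
theorem isDedekindDomain_integralClosure_of_finite (hdim : ringKrullDim R ≤ 1)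
    [Module.Finite R (integralClosure R (FractionRing R))] :
    IsDedekindDomain (integralClosure R (FractionRing R)) := by
  haveI : IsNoetherianRing (integralClosure R (FractionRing R)) :=
    isNoetherian_of_tower R (isNoetherian_of_isNoetherianRing_of_finite R _)
  haveI : Ring.KrullDimLE 1 R := Ring.krullDimLE_iff.mpr hdim
  haveI : Ring.DimensionLEOne R :=
    ⟨fun hne hp => (Ring.krullDimLE_one_iff_of_noZeroDivisors.mp inferInstance) _ hne hp⟩
  haveI : IsFractionRing (integralClosure R (FractionRing R)) (FractionRing R) :=
    integralClosure.isFractionRing_of_finite_extension (FractionRing R) (FractionRing R)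
  haveI : IsIntegrallyClosed (integralClosure R (FractionRing R)) :=
    (isIntegrallyClosed_iff_isIntegrallyClosedIn (FractionRing R)).mpr inferInstance
  exact { }

/-- **Kollár Thm. 1.101, (2) ⇒ (3), for local domains**: if the normalization of a Noetherian
local domain `R` of dimension `≤ 1` is a finite `R`-module, then the `𝔪`-adic completion `R̂` is
reduced. Printed proof: `R̂ ⊆ R̄ ⊗ R̂ = (R̄)^ = Π_𝔫 (R̄_𝔫)^` (flatness of `R̂`, Matsumura 8.7/8.15),
and each `(R̄_𝔫)^` is the completion of a regular local ring (a DVR), hence a regular local ring,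
hence a domain. [cite: Kollar2007, Thm. 1.101] -/
theorem isReduced_adicCompletion_of_finite_integralClosure [IsLocalRing R]
    (hdim : ringKrullDim R ≤ 1) [Module.Finite R (integralClosure R (FractionRing R))] :
    IsReduced (AdicCompletion (maximalIdeal R) R) := by
  set C : Type u := ↥(integralClosure R (FractionRing R))
  haveI : IsDedekindDomain C := isDedekindDomain_integralClosure_of_finite R hdim
  -- each `(C_𝔫)^` is a domain
  haveI : ∀ n : MaximalSpectrum C, IsReduced
      (AdicCompletion (maximalIdeal (Localization.AtPrime n.asIdeal))
        (Localization.AtPrime n.asIdeal)) := fun n => by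
    haveI := n.isMaximal
    haveI hreg := isRegularLocalRing_adicCompletion (Localization.AtPrime n.asIdeal)
    haveI := @isDomain_of_isRegularLocalRing _ _ hreg
    infer_instance
  -- `C ⊗ R̂ ≅ Π (C_𝔫)^` is reduced
  haveI : IsReduced (C ⊗[R] AdicCompletion (maximalIdeal R) R) :=
    isReduced_of_injective (Stacks07N9_local R C) (Stacks07N9_local R C).injective
  -- `R̂ ↪ C ⊗ R̂` by flatness of `R̂`
  have hinj : Function.Injective (algebraMap R C) := fun a b h => by
    have := congrArg (fun z : C => (z : FractionRing R)) h
    exact IsFractionRing.injective R (FractionRing R) this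
  exact isReduced_of_injective
    (Algebra.TensorProduct.includeRight : AdicCompletion (maximalIdeal R) R →ₐ[R]
      C ⊗[R] AdicCompletion (maximalIdeal R) R)
    (Algebra.TensorProduct.includeRight_injective hinj)

end FiniteNormalization

/-! ## Integral equations with cleared denominators -/

section Relations

/-- If `b = a/s` (`b·s = a`) is integral over `R`, with monic equation of degree `n` and lower
coefficients `cᵢ`, then `aⁿ + Σ_{i<n} cᵢ aⁱ sⁿ⁻ⁱ = 0` in `R` (clear denominators). [folklore] -/
theorem exists_homogeneous_rel_of_isIntegral {R K : Type*} [CommRing R] [CommRing K] [Algebra R K]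
    (hinj : Function.Injective (algebraMap R K)) {b : K} (hb : IsIntegral R b) {a s : R}
    (h : b * algebraMap R K s = algebraMap R K a) :
    ∃ (n : ℕ) (c : ℕ → R), a ^ n + ∑ i ∈ Finset.range n, c i * a ^ i * s ^ (n - i) = 0 := by
  obtain ⟨p, hp, hpb⟩ := hb
  refine ⟨p.natDegree, p.coeff, hinj ?_⟩
  have h1 : (Polynomial.aeval b p) * algebraMap R K s ^ p.natDegree = 0 := by
    rw [Polynomial.aeval_def, hpb, zero_mul]
  rw [Polynomial.aeval_eq_sum_range, Finset.sum_range_succ, hp.coeff_natDegree, one_smul, add_mul,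
    Finset.sum_mul] at h1
  rw [map_zero, ← h1, map_add, map_pow, ← h, mul_pow, map_sum, add_comm]
  congr 1
  refine Finset.sum_congr rfl fun i hi => ?_
  have hle : i ≤ p.natDegree := le_of_lt (Finset.mem_range.mp hi)
  have hs : algebraMap R K s ^ i * algebraMap R K s ^ (p.natDegree - i) =
      algebraMap R K s ^ p.natDegree := by
    rw [← pow_add, Nat.add_sub_of_le hle]
  rw [map_mul, map_mul, map_pow, map_pow, ← h, mul_pow, Algebra.smul_def, ← hs]
  ring

/-- Conversely, over a domain `D` with fraction field `K`: if `aⁿ + Σ_{i<n} cᵢ aⁱ sⁿ⁻ⁱ = 0` and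
`s ≠ 0` then `a/s ∈ K` is integral over `D` (root of `Xⁿ + Σ cᵢ Xⁱ`). [folklore] -/
theorem isIntegral_div_of_homogeneous_rel {D K : Type*} [CommRing D] [Field K] [Algebra D K]
    {a s : D} (hs : algebraMap D K s ≠ 0) {n : ℕ} {c : ℕ → D}
    (h : a ^ n + ∑ i ∈ Finset.range n, c i * a ^ i * s ^ (n - i) = 0) :
    IsIntegral D (algebraMap D K a / algebraMap D K s) := by
  set q : D[X] := X ^ n + ∑ i ∈ Finset.range n, C (c i) * X ^ i with hq
  have hdeg : (∑ i ∈ Finset.range n, C (c i) * X ^ i).degree < (n : WithBot ℕ) := by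
    rw [Finset.sum_range]
    exact Polynomial.degree_sum_fin_lt _
  have hmonic : q.Monic := Polynomial.monic_X_pow_add hdeg
  refine ⟨q, hmonic, ?_⟩
  rw [← Polynomial.aeval_def]
  set x : K := algebraMap D K a / algebraMap D K s with hx
  have hxs : x * algebraMap D K s = algebraMap D K a := by rw [hx, div_mul_cancel₀ _ hs]
  have heval : Polynomial.aeval x q = x ^ n + ∑ i ∈ Finset.range n, algebraMap D K (c i) * x ^ i := by
    simp only [hq, map_add, map_pow, Polynomial.aeval_X, map_sum, map_mul, Polynomial.aeval_C]
  have hmul : Polynomial.aeval x q * algebraMap D K s ^ n = algebraMap D K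
      (a ^ n + ∑ i ∈ Finset.range n, c i * a ^ i * s ^ (n - i)) := by
    rw [heval, add_mul, Finset.sum_mul, map_add, map_pow, ← hxs, mul_pow, map_sum]
    congr 1
    refine Finset.sum_congr rfl fun i hi => ?_
    have hle : i ≤ n := le_of_lt (Finset.mem_range.mp hi)
    have hs' : algebraMap D K s ^ i * algebraMap D K s ^ (n - i) = algebraMap D K s ^ n := by
      rw [← pow_add, Nat.add_sub_of_le hle]
    rw [map_mul, map_mul, map_pow, map_pow, ← hxs, mul_pow, ← hs']
    ring
  rw [h, map_zero] at hmul
  exact (mul_eq_zero.mp hmul).resolve_right (pow_ne_zero _ hs)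

end Relations

/-! ## The conductor of a complete one-dimensional local domain into its normalization -/

section Conductor

variable (D : Type u) [CommRing D] [IsDomain D] [IsLocalRing D] [IsNoetherianRing D]
  [IsAdicComplete (maximalIdeal D) D]

/-- For a complete one-dimensional Noetherian local domain `D` and `y ∈ 𝔪_D` there is `N` with
`y^N · D̄ ⊆ D` (`D̄` the normalization): `D̄` is finite over `D` (Nagata / Kiyek–Vicente II
(3.17), the tree's `module_finite_integralClosure_of_complete`), so has a common denominator
`d ≠ 0`, and `y ∈ √(d) = 𝔪_D`. [cite: Kollar2007, Thm. 1.102] -/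
theorem exists_pow_mul_mem_range_of_complete (hdim : ringKrullDim D = 1) {y : D}
    (hy : y ∈ maximalIdeal D) :
    ∃ N : ℕ, ∀ w : integralClosure D (FractionRing D), ∃ t : D,
      algebraMap D (integralClosure D (FractionRing D)) (y ^ N) * w =
        algebraMap D (integralClosure D (FractionRing D)) t := by
  classical
  set W := integralClosure D (FractionRing D) with hW
  haveI := module_finite_integralClosure_of_complete D hdim
  obtain ⟨T, hT⟩ := Module.Finite.fg_top (R := D) (M := W)
  have hgen : ∀ w : W, ∃ a b : D, algebraMap D W b ≠ 0 ∧ w * algebraMap D W b = algebraMap D W a :=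
    fun w => exists_mul_algebraMap_eq_of_mem_integralClosure D w
  choose fa fb hfb hfab using hgen
  set d : D := ∏ w ∈ T, fb w with hd
  have hd0 : d ≠ 0 := Finset.prod_ne_zero_iff.mpr fun w _ h0 => hfb w (by rw [h0, map_zero])
  have hdT : ∀ w ∈ T, ∃ a : D, w * algebraMap D W d = algebraMap D W a := by
    intro w hw
    obtain ⟨d', hd'⟩ : fb w ∣ d := Finset.dvd_prod_of_mem _ hw
    refine ⟨fa w * d', ?_⟩
    rw [hd', map_mul, ← mul_assoc, hfab w, map_mul]
  have hdall : ∀ w : W, ∃ a : D, w * algebraMap D W d = algebraMap D W a := by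
    intro w
    have hw : w ∈ Submodule.span D (T : Set W) := by rw [hT]; trivial
    refine Submodule.span_induction (p := fun w _ => ∃ a : D, w * algebraMap D W d = algebraMap D W a)
      ?_ ?_ ?_ ?_ hw
    · exact fun w hw => hdT w hw
    · exact ⟨0, by rw [zero_mul, map_zero]⟩
    · rintro w₁ w₂ - - ⟨a₁, h₁⟩ ⟨a₂, h₂⟩
      exact ⟨a₁ + a₂, by rw [add_mul, h₁, h₂, map_add]⟩
    · rintro r w - ⟨a, ha⟩
      exact ⟨r * a, by rw [smul_mul_assoc, ha, Algebra.smul_def, map_mul]⟩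
  obtain ⟨-, hrad⟩ := ringKrullDim_eq_one_iff_of_isLocalRing_isDomain.mp hdim
  obtain ⟨N, hN⟩ : ∃ N : ℕ, y ^ N ∈ Ideal.span {d} := hrad d hd0 hy
  obtain ⟨e, he⟩ := Ideal.mem_span_singleton'.mp hN
  refine ⟨N, fun w => ?_⟩
  obtain ⟨a, ha⟩ := hdall w
  refine ⟨e * a, ?_⟩
  rw [← he, map_mul, mul_assoc, mul_comm (algebraMap D W d) w, ha, map_mul]

end Conductor

/-! ## Patching modulo the minimal primes of a reduced ring -/

section Patching

/-- In a reduced ring with finitely many minimal primes there is an element `e` outside every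
minimal prime such that `e·z ∈ I` whenever `z ∈ I + 𝔭` for every minimal prime `𝔭`
(`e = Σ_𝔭 e_𝔭` with `e_𝔭 ∈ ⋂_{𝔮 ≠ 𝔭} 𝔮 ∖ 𝔭`, using `⋂_𝔮 𝔮 = 0`). [folklore] -/
theorem exists_notMem_minimalPrimes_forall_mul_mem (S : Type*) [CommRing S] [IsReduced S]
    (hfin : (minimalPrimes S).Finite) :
    ∃ e : S, (∀ p ∈ minimalPrimes S, e ∉ p) ∧
      ∀ (I : Ideal S) (z : S), (∀ p ∈ minimalPrimes S, z ∈ I ⊔ p) → e * z ∈ I := by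
  classical
  have key : ∀ p ∈ minimalPrimes S, ∃ t : S, t ∉ p ∧ ∀ q ∈ minimalPrimes S, q ≠ p → t ∈ q := by
    intro p hp
    haveI hpprime : p.IsPrime := IsMinimalPrime.isPrime hp
    by_contra! H
    have hle : (hfin.toFinset.erase p).inf id ≤ p := by
      intro t ht
      by_contra htp
      obtain ⟨q, hq, hqp, htq⟩ := H t htp
      refine htq ?_
      have hinf : (hfin.toFinset.erase p).inf id ≤ q :=
        Finset.inf_le (Finset.mem_erase.mpr ⟨hqp, hfin.mem_toFinset.mpr hq⟩)
      exact hinf ht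
    obtain ⟨q, hq, hqp⟩ := hpprime.inf_le'.mp hle
    rw [Finset.mem_erase] at hq
    have hqmin : q ∈ minimalPrimes S := hfin.mem_toFinset.mp hq.2
    have hpq : p ≤ q := hp.2 ⟨IsMinimalPrime.isPrime hqmin, bot_le⟩ hqp
    exact hq.1 (le_antisymm hqp hpq)
  choose! t ht_notMem ht_mem using key
  refine ⟨∑ p ∈ hfin.toFinset, t p, fun p hp he => ?_, fun I z hz => ?_⟩
  · have hsplit := Finset.add_sum_erase hfin.toFinset t (hfin.mem_toFinset.mpr hp)
    have hrest : ∑ q ∈ hfin.toFinset.erase p, t q ∈ p := by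
      refine Ideal.sum_mem _ fun q hq => ?_
      rw [Finset.mem_erase] at hq
      exact ht_mem q (hfin.mem_toFinset.mp hq.2) p hp (Ne.symm hq.1)
    rw [← hsplit] at he
    exact ht_notMem p hp ((Submodule.add_mem_iff_left p hrest).mp he)
  · rw [Finset.sum_mul]
    refine Ideal.sum_mem _ fun p hp => ?_
    have hpmin : p ∈ minimalPrimes S := hfin.mem_toFinset.mp hp
    obtain ⟨i, hi, r, hr, hzir⟩ := Submodule.mem_sup.mp (hz p hpmin)
    rw [← hzir, mul_add]
    refine I.add_mem (I.mul_mem_left _ hi) ?_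
    have h0 : t p * r ∈ sInf (minimalPrimes S) := by
      rw [Submodule.mem_sInf]
      intro q hq
      by_cases hqp : q = p
      · subst hqp; exact Ideal.mul_mem_left _ _ hr
      · exact Ideal.mul_mem_right _ _ (ht_mem p hpmin q hq hqp)
    have hinf : sInf (minimalPrimes S) = ⊥ := by
      change sInf ((⊥ : Ideal S).minimalPrimes) = ⊥
      rw [Ideal.sInf_minimalPrimes, ← Ideal.zero_eq_bot, ← nilradical, nilradical_eq_zero]
    rw [hinf, Submodule.mem_bot] at h0
    rw [h0]
    exact I.zero_mem

/-- In a local ring of dimension `≤ 1`, an element outside all minimal primes generates an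
`𝔪`-primary ideal: every `x ∈ 𝔪` has a power in `(e)`. [folklore] -/
theorem exists_pow_mem_span_of_notMem_minimalPrimes (S : Type*) [CommRing S] [IsLocalRing S]
    (hdim : ringKrullDim S ≤ 1) {e : S} (he : ∀ p ∈ minimalPrimes S, e ∉ p) {x : S}
    (hx : x ∈ maximalIdeal S) : ∃ M : ℕ, x ^ M ∈ Ideal.span {e} := by
  haveI : Ring.KrullDimLE 1 S := Ring.krullDimLE_iff.mpr hdim
  suffices h : x ∈ (Ideal.span {e}).radical from h
  rw [Ideal.radical_eq_sInf, Submodule.mem_sInf]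
  rintro J ⟨hJ, hJprime⟩
  rcases (Ring.krullDimLE_one_iff.mp inferInstance) J hJprime with hmin | hmax
  · exact absurd (hJ (Ideal.mem_span_singleton_self e)) (he J hmin)
  · rw [IsLocalRing.eq_maximalIdeal hmax]
    exact hx

end Patching

end Literature.AlgebraicGeometry.Resolution

end
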